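import Mathlib

/-!
# Positive definiteness from Gershgorin discs after a congruence — D2-CHAIN-MAP step S4 (c) (cap g6, cell `ns-blowup`, 2026-08-26)

HONEST FRAMING (human ruling D-0035): nothing here is a claim about Navier–Stokes blow-up.
WHAT THIS IS NOT: not NS evidence. The LOGIC of the positivity test every skew-cut / 3-L / 3-B
certificate script of the cell uses (`skc.certify_hpd_lower`, selfsim g3; used UNMODIFIED by
`d2_cert.py`, `nested_cert.py`, cap2's `d2s_cert.py`): to certify `λ_min(H) > t` for a Hermitian
ball matrix `H`, take the FLOAT eigenvector matrix `Q`, form `B = Qᴴ (H − t·1) Q` in ball arithmetic,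
and check that every Gershgorin row of `B` lies strictly in the right half-plane. The referee read
(REFEREE-KERNEL-G25 §5, STATUS l.3133) recorded the implication «strict ball row gaps on `B` ⇒ `Q`
injective ⇒ Sylvester `H − t ≻ 0`» as SOUND by code read; this file makes it a theorem:

* `eigenvalues_pos_of_gershgorin` / `posDef_of_gershgorin` — a Hermitian matrix over `ℝ`/`ℂ`
  whose rows satisfy `∑_{j ≠ i} ‖B i j‖ < Re (B i i)` is positive definite (Gershgorin's circle
  theorem `eigenvalue_mem_ball` at each eigenvalue of the spectral decomposition);
* `mulVec_injective_of_posDef_congruence` — if `Qᴴ H Q` is positive definite then `Q` is injective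
  (no hypothesis on `Q`: the float eigenvectors need not be accurate, orthogonal or even invertible
  a priori — injectivity is a CONSEQUENCE);
* `posDef_of_congruence_gershgorin` — **S4 (c)**: `H` Hermitian and the rows of `Qᴴ H Q`
  Gershgorin-positive ⇒ `H` positive definite; `posDef_sub_of_congruence_gershgorin` — the shifted
  form the scripts print («`λ_min(H) ≥ t` certified»): rows of `Qᴴ (H − t·1) Q` Gershgorin-positive ⇒
  `H − t·1` positive definite.

PRIOR ART IN THE TREE (searched `Gershgorin`): `Literature.Analysis.ValidatedNumerics.IntervalGershgorin`
(`posSemidef_of_diagDominant`, `posSemidef_of_congr`, `isUnit_of_gram_strictDiagDominant` — REAL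
symmetric matrices, positive SEMI-definiteness, the congruence `V` assumed invertible or checked by an
integer Gram test) and `Literature.Analysis.Matrix.DiagonallyDominantRelaxation`; the present file is
the `RCLike`-Hermitian, STRICT (positive definite) version the cell's complex class-reduced
certificates need, with the invertibility of `Q` DERIVED from the test rather than assumed.
The ball arithmetic (outward rounding of the entries of `B`) stays the script's; what is kernel is
that the printed test implies the claimed inequality. Mathlib only; no new definitions; std axioms.
-/

namespace Summit.NavierStokesRegularity.FluidComputer.CongruenceGershgorinPosDef

open Matrix RCLike
open scoped ComplexOrder

variable {𝕜 : Type*} [RCLike 𝕜] {n : Type*} [Fintype n] [DecidableEq n]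

/-- **Gershgorin rows in the open right half-plane ⇒ all eigenvalues of a Hermitian matrix are
positive.** -/
theorem eigenvalues_pos_of_gershgorin {B : Matrix n n 𝕜} (hB : B.IsHermitian)
    (hdom : ∀ i, (∑ j ∈ Finset.univ.erase i, ‖B i j‖) < re (B i i)) (j : n) :
    0 < hB.eigenvalues j := by
  set v : n → 𝕜 := ⇑(hB.eigenvectorBasis j) with hv
  have hv0 : v ≠ 0 := by
    intro h
    have h1 : ‖hB.eigenvectorBasis j‖ = 1 := hB.eigenvectorBasis.orthonormal.1 j
    have h2 : hB.eigenvectorBasis j = 0 := by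
      ext i
      have := congrFun h i
      simpa [hv] using this
    rw [h2, norm_zero] at h1
    exact zero_ne_one h1
  have hmem : v ∈ Module.End.eigenspace (Matrix.toLin' B) ((hB.eigenvalues j : ℝ) : 𝕜) := by
    rw [Module.End.mem_eigenspace_iff, Matrix.toLin'_apply, hv, hB.mulVec_eigenvectorBasis j,
      RCLike.real_smul_eq_coe_smul (K := 𝕜)]
  have hμ : Module.End.HasEigenvalue (Matrix.toLin' B) ((hB.eigenvalues j : ℝ) : 𝕜) :=
    Module.End.hasEigenvalue_of_hasEigenvector ⟨hmem, hv0⟩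
  obtain ⟨k, hk⟩ := eigenvalue_mem_ball hμ
  rw [Metric.mem_closedBall, dist_eq_norm] at hk
  have hre : re (B k k) - hB.eigenvalues j ≤ ‖((hB.eigenvalues j : ℝ) : 𝕜) - B k k‖ := by
    have h1 : re (B k k) - hB.eigenvalues j = re (B k k - ((hB.eigenvalues j : ℝ) : 𝕜)) := by
      rw [map_sub, ofReal_re]
    rw [h1, ← norm_neg, neg_sub]
    exact RCLike.re_le_norm _
  have := hdom k
  linarith

/-- **Hermitian + Gershgorin-positive rows ⇒ positive definite.** -/
theorem posDef_of_gershgorin {B : Matrix n n 𝕜} (hB : B.IsHermitian)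
    (hdom : ∀ i, (∑ j ∈ Finset.univ.erase i, ‖B i j‖) < re (B i i)) : B.PosDef :=
  hB.posDef_iff_eigenvalues_pos.mpr (eigenvalues_pos_of_gershgorin hB hdom)

omit [DecidableEq n] in
/-- **A congruence that produces a positive definite matrix is injective.** If `Qᴴ H Q` is positive
definite then `Q.mulVec` is injective (hence `Q` is invertible when square). -/
theorem mulVec_injective_of_posDef_congruence {H Q : Matrix n n 𝕜} (hB : (Qᴴ * H * Q).PosDef) :
    Function.Injective Q.mulVec := by
  intro x y hxy
  by_contra hne
  have hz : x - y ≠ 0 := sub_ne_zero.mpr hne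
  have hpos := hB.dotProduct_mulVec_pos hz
  have hQ : Q *ᵥ (x - y) = 0 := by rw [mulVec_sub, hxy, sub_self]
  have h0 : (Qᴴ * H * Q) *ᵥ (x - y) = 0 := by
    rw [← mulVec_mulVec, ← mulVec_mulVec, hQ, mulVec_zero, mulVec_zero]
  rw [h0, dotProduct_zero] at hpos
  exact lt_irrefl _ hpos

/-- **D2-CHAIN-MAP S4 (c): Gershgorin after a congruence certifies positive definiteness.** If
`H` is Hermitian and, for some matrix `Q` (in practice the float eigenvector matrix), every row of
`B = Qᴴ H Q` satisfies `∑_{j ≠ i} ‖B i j‖ < Re (B i i)`, then `H` is positive definite. No a-priori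
property of `Q` is assumed. -/
theorem posDef_of_congruence_gershgorin {H Q : Matrix n n 𝕜} (hH : H.IsHermitian)
    (hdom : ∀ i, (∑ j ∈ Finset.univ.erase i, ‖(Qᴴ * H * Q) i j‖) < re ((Qᴴ * H * Q) i i)) :
    H.PosDef := by
  have hBh : (Qᴴ * H * Q).IsHermitian := isHermitian_conjTranspose_mul_mul Q hH
  have hB : (Qᴴ * H * Q).PosDef := posDef_of_gershgorin hBh hdom
  have hU : IsUnit Q := mulVec_injective_iff_isUnit.mp (mulVec_injective_of_posDef_congruence hB)
  have hB' : (star Q * H * Q).PosDef := by rwa [star_eq_conjTranspose]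
  exact (Matrix.IsUnit.posDef_star_left_conjugate_iff hU).mp hB'

/-- **The shifted form the scripts print: `λ_min(H) > t` certified.** If `H` is Hermitian, `t` real,
and the rows of `Qᴴ (H − t·1) Q` are Gershgorin-positive, then `H − t·1` is positive definite
(so every eigenvalue of `H` exceeds `t`, and `⟨x, Hx⟩ > t‖x‖²` for `x ≠ 0`). -/
theorem posDef_sub_of_congruence_gershgorin {H Q : Matrix n n 𝕜} (hH : H.IsHermitian) (t : ℝ)
    (hdom : ∀ i, (∑ j ∈ Finset.univ.erase i, ‖(Qᴴ * (H - (t : 𝕜) • (1 : Matrix n n 𝕜)) * Q) i j‖)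
      < re ((Qᴴ * (H - (t : 𝕜) • (1 : Matrix n n 𝕜)) * Q) i i)) :
    (H - (t : 𝕜) • (1 : Matrix n n 𝕜)).PosDef := by
  have hS : (H - (t : 𝕜) • (1 : Matrix n n 𝕜)).IsHermitian := by
    refine hH.sub ?_
    rw [IsHermitian, conjTranspose_smul, conjTranspose_one, RCLike.star_def, conj_ofReal]
  exact posDef_of_congruence_gershgorin hS hdom

end Summit.NavierStokesRegularity.FluidComputer.CongruenceGershgorinPosDef
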